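import Literature.NumberTheory.EllipticCurves.QuarticTwistThetaDictionary
import Literature.NumberTheory.EllipticCurves.AnalyticRank
import HarnessLib

/-!
# `L(E_D, s)` is entire for every `E_D : y² = x³ − D x`, `D ≠ 0` free of fourth powers (Ireland–Rosen, Ch. 18 §5 Thm. 6, §6 Thm. 7)

Topic `Literature/NumberTheory/EllipticCurves`, namespace `Literature.NumberTheory.EllipticCurves.QuarticTwist` (sequel to
`QuarticTwistThetaDictionary`). THEOREMS ONLY (no definition, no named fact).

Source: K. Ireland, M. Rosen, *A Classical Introduction to Modern Number Theory*, 2nd ed., GTM 84 (1990), Ch. 18 §6, Theorem 7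
(PDF p. 304): «`L(E, s) = L(s, χ)`» for `E : y² = x³ − Dx` and the Hecke character `χ` of `ℤ[i]` attached to the quartic residue
symbol `(D/·)₄`, together with §5 Theorem 6 (Hecke): «`L(s, χ)` can be analytically continued to an entire function». The tree proves the
twisted identity `Σ_n c(n) a_n(E_D) n^{-s} = ¼ · Θ-L_{8|D|m}(Ψ)(s)` for `Re s > 3/2` and the entire continuation of the right-hand side
(`QuarticTwist.lSeries_twist_eq_thetaLFunction`, `QuarticTwist.exists_differentiable_twist`, with Hecke's continuation of weight-one theta
series of `ℤ[i]` from `LFunctions.GaussianThetaSeries`). This file reads off the untwisted case `m = 1`, `c = 1` in the vocabulary of the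
BSD prelude (`WeierstrassCurve.HasEntireLFunction`: `W.LSeries` has an entire continuation from `Re s > 3/2`, Silverman AEC C.16):

* `hasEntireLFunction_neg` — **`(y² = x³ − Dx).HasEntireLFunction`** for every `D ≠ 0` free of fourth powers;
* `hasEntireLFunction` — **`(y² = x³ + Ax).HasEntireLFunction`** for every `A ≠ 0` free of fourth powers (`D = −A`).

This is the `D`-general twin of `CongruentNumberCurveLSeriesProofs.hasEntireLFunction_congruentNumberCurve_holds` (`D = n²`), and it
discharges the Deuring–Hecke continuation leaf `hasEntireLFunction_of_j_mem_maximalCMJInvariants` on the whole `j = 1728` family of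
fourth-power-free models (every elliptic curve over `ℚ` with `j = 1728` has such a model `y² = x³ + Ax`). Nothing about BSD is proved here.

## References
* K. Ireland, M. Rosen, *A Classical Introduction to Modern Number Theory*, 2nd ed., GTM 84 (1990), Ch. 18 §5 Thm. 6, §6 Thm. 7.
  [IrelandRosen1990]
* N. Koblitz, *Introduction to Elliptic Curves and Modular Forms*, GTM 97 (1993), Ch. II §5 (theta continuation). [Koblitz1993]
* J. H. Silverman, *The Arithmetic of Elliptic Curves*, 2nd ed., GTM 106 (2009), App. C §16. [SilvermanAEC2009]

## Mathlib / tree search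
Tree: `QuarticTwist.exists_differentiable_twist` (`QuarticTwistThetaDictionary`), `WeierstrassCurve.HasEntireLFunction`,
`WeierstrassCurve.entireContinuations` (`AnalyticRank`), `hasEntireLFunction_congruentNumberCurve_holds` (the `D = n²` case). Mathlib:
`WeierstrassCurve.LSeries`, `LSeries_congr`.
-/

noncomputable section

namespace Literature.NumberTheory.EllipticCurves

namespace QuarticTwist

open WeierstrassCurve

/-- **`L(E_D, s)` is entire** for `E_D : y² = x³ − D x`, `D ≠ 0` free of fourth powers: the untwisted case (`m = 1`, `c = 1`) of the
theta dictionary `Σ c(n) a_n(E_D) n^{-s} = ¼ Θ-L(Ψ)(s)` with Hecke's continuation of the theta series (Ireland–Rosen Thm. 18.7 with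
Thm. 18.6), in the BSD prelude's vocabulary `WeierstrassCurve.HasEntireLFunction`.
[cite: IrelandRosen1990, Ch. 18 §6 Theorem 7 and §5 Theorem 6] -/
theorem hasEntireLFunction_neg {D : ℤ} (hD : D ≠ 0) (hD4 : ∀ p : ℕ, p.Prime → ¬ (p : ℤ) ^ 4 ∣ D) :
    ((⟨0, 0, 0, -(D : ℚ), 0⟩ : WeierstrassCurve ℚ)).HasEntireLFunction := by
  obtain ⟨L, hL, hLs⟩ := exists_differentiable_twist (m := 1) hD hD4 (fun _ ↦ (1 : ℂ))
  refine ⟨L, hL, fun s hs ↦ ?_⟩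
  rw [hLs s hs, WeierstrassCurve.LSeries]
  exact LSeries_congr (fun {n} _ ↦ by simp) s

/-- **`L(y² = x³ + A x, s)` is entire** for every `A ≠ 0` free of fourth powers (`D = −A` in `hasEntireLFunction_neg`) — the whole
fourth-power-free `j = 1728` family, e.g. the quartic twists `y² = x³ + p^k q² l² x` of the BSD programme's CM-inert-bad corner.
[cite: IrelandRosen1990, Ch. 18 §6 Theorem 7 and §5 Theorem 6] -/
theorem hasEntireLFunction {A : ℤ} (hA : A ≠ 0) (hA4 : ∀ p : ℕ, p.Prime → ¬ (p : ℤ) ^ 4 ∣ A) :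
    ((⟨0, 0, 0, (A : ℚ), 0⟩ : WeierstrassCurve ℚ)).HasEntireLFunction := by
  have h := hasEntireLFunction_neg (D := -A) (neg_ne_zero.mpr hA) (fun p hp h4 ↦ hA4 p hp ((dvd_neg).mp h4))
  have hcast : (-((-A : ℤ) : ℚ)) = (A : ℚ) := by push_cast; ring
  rwa [hcast] at h

end QuarticTwist

end Literature.NumberTheory.EllipticCurves

end
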